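import Summits.CriticalPhenomena.PercolationContinuityZ3.Theorems.PercNearOneGluingNoHeavyLowerTailKnQuestion8CoefficientwiseCoreClassKernelMixChordedClass
import Summits.CriticalPhenomena.PercolationContinuityZ3.Theorems.PercNearOneGluingNoHeavyLowerTailKnQuestion8CoefficientwiseCoreClassKernelMixBundleBoundary
import HarnessLib

/-!
# Chorded bundles, IV: THEOREM CT4-COUNT — the clean-thread count for `Θ(ℓ_z,ℓ_x,ℓ_y,1)`

Support file (`--supports stmt-CriticalPhenomena-4575`, closed), prover `prim-cplus-coupling` (gen 60).  No definitions, no notations, no named facts,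
no sorries; standard axioms.  Memo `prim-cplus-coupling/A5-COUPLING-gen60.md` §1, §4(A).

SETTING.  An explicit bundle whose threads are exactly `z, x, y, c` with `L c = 1` (the chord); `𝒱` up-closed; `{0,1}`-valued monotone levels; `B_z` = the
colourings blue-starting on `z` (`e z 1` blue, `z` not all blue).
* `Coefficientwise.bundle_chorded_ct_count` (THEOREM CT4-COUNT): `#bad(𝒱 ∖ B_z) ≤ #(L₁ ∪ L₂)(𝒱 ∩ {e z 1 red}) + #P₁(𝒱 ∖ B_z)` — the `z`-blue sources
  by THEOREM BI (`bundle_boundary_count` with `z` and the chord as the frozen threads: landings `z`-full, joins `z`-blue), every red-prefix class `R_a(z)` by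
  the CLASS THEOREM (`bundle_chorded_class_count`: supply points and joins inside the class); the pools are pairwise disjoint.
The real-level corollary (all monotone levels) is `iet_chorded_clean_thread` in `…KernelMixChordedCleanThreadIET`.
Exact SAT cross-checks (all 0/1 levels, all up-sets): CT4C UNSAT on Θ(1,2,2,3), Θ(1,2,3,3), Θ(1,3,3,3), Θ(1,2,3,4) (kit j237488).
[cite: KozmaNitzan2024, Questions 8–9 (§5.5 p. 36) (context); Harris 1960]
-/

namespace Summit.CriticalPhenomena.PercolationContinuityZ3.Theorems

open Finset Literature.Probability.Percolation

namespace Coefficientwise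

variable {ι V : Type*}

open Classical in
/-- **THEOREM CT4-COUNT (chorded bundle `Θ(ℓ_z,ℓ_x,ℓ_y,1)`, all 0/1 levels, every up-set, every long thread `z`).**  The sources of `𝒱` that are NOT
blue-starting on `z` (`e z 1` red, or `z` all blue) are at most the `(L₁ ∪ L₂)`-supply points of `𝒱` starting red on `z` plus the `P₁` joins of `𝒱` not
blue-starting on `z`:  `#bad(𝒱 ∖ B_z) ≤ #(L₁ ∪ L₂)(𝒱 ∩ {e z 1 red}) + #P₁(𝒱 ∖ B_z)`.  PROOF: the `z`-blue sources are THEOREM BI (`bundle_boundary_count` with the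
other threads `z` AND the chord frozen: landings `z`-full); a source starting red on `z` lies in exactly one class `R_a(z)`, which pays for itself
(`bundle_chorded_class_count`); the pools are pairwise disjoint.  Memo gen 60 §1.  [cite: KozmaNitzan2024, Questions 8–9 (§5.5 p. 36) (context); Harris 1960] -/
theorem bundle_chorded_ct_count (ends : ι → Sym2 V) (r : ℕ) (L : ℕ → ℕ) (hL : ∀ t, t < r → 1 ≤ L t)
    (w : ℕ → ℕ → V) (e : ℕ → ℕ → ι) (u b : V)
    (hw0 : ∀ t, t < r → w t 0 = u) (hwL : ∀ t, t < r → w t (L t) = b)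
    (harc : ∀ t, t < r → ∀ j, 1 ≤ j → j ≤ L t → ends (e t j) = s(w t (j - 1), w t j))
    (hwinj : ∀ t, t < r → ∀ i j, i ≤ L t → j ≤ L t → w t i = w t j → i = j)
    (hcross : ∀ t t', t < r → t' < r → t ≠ t' → ∀ i j, i ≤ L t → j ≤ L t' → w t i = w t' j → (i = 0 ∧ j = 0) ∨ (i = L t ∧ j = L t'))
    (A : ℕ → Finset ι) (hA : ∀ t, t < r → ∀ i, i ∈ A t ↔ ∃ j, 1 ≤ j ∧ j ≤ L t ∧ e t j = i)
    (hAdisj : ∀ t t', t < r → t' < r → t ≠ t' → Disjoint (A t) (A t'))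
    (E : Finset ι) (hEA : ∀ i, i ∈ E ↔ ∃ t, t < r ∧ i ∈ A t)
    (z x y c : ℕ) (hz : z < r) (hx : x < r) (hy : y < r) (hc : c < r)
    (hzx : z ≠ x) (hzy : z ≠ y) (hzc : z ≠ c) (hxy : x ≠ y) (hxc : x ≠ c) (hyc : y ≠ c)
    (hr4 : ∀ t, t < r → t = z ∨ t = x ∨ t = y ∨ t = c) (hLc : L c = 1)
    (𝒱 : Finset ι → Prop) (hV : ∀ ⦃s t : Finset ι⦄, s ⊆ t → 𝒱 s → 𝒱 t)
    (ha hb ka kb : Set V → ℝ) (mha : Monotone ha) (mhb : Monotone hb) (mka : Monotone ka) (mkb : Monotone kb)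
    (ha01 : ∀ S, ha S = 0 ∨ ha S = 1) (hb01 : ∀ S, hb S = 0 ∨ hb S = 1) (ka01 : ∀ S, ka S = 0 ∨ ka S = 1) (kb01 : ∀ S, kb S = 0 ∨ kb S = 1) :
    ((E.powerset).filter (fun σ => (e z 1 ∈ σ ∨ Disjoint (A z) σ) ∧ 𝒱 σ ∧
        (b ∈ openCluster (ends '' (↑(E \ σ) : Set ι)) u ∧ b ∉ openCluster (ends '' (↑σ : Set ι)) u) ∧
        (ha (openCluster (ends '' (↑σ : Set ι)) u) = 1 ∧ hb (openCluster (ends '' (↑(E \ σ) : Set ι)) u) = 0) ∧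
        (kb (openCluster (ends '' (↑(E \ σ) : Set ι)) u) = 1 ∧ ka (openCluster (ends '' (↑σ : Set ι)) u) = 0))).card
    + ((E.powerset).filter (fun σ => (e z 1 ∈ σ ∨ Disjoint (A z) σ) ∧ 𝒱 σ ∧
        (b ∈ openCluster (ends '' (↑(E \ σ) : Set ι)) u ∧ b ∉ openCluster (ends '' (↑σ : Set ι)) u) ∧
        (ka (openCluster (ends '' (↑σ : Set ι)) u) = 1 ∧ kb (openCluster (ends '' (↑(E \ σ) : Set ι)) u) = 0) ∧
        (hb (openCluster (ends '' (↑(E \ σ) : Set ι)) u) = 1 ∧ ha (openCluster (ends '' (↑σ : Set ι)) u) = 0))).card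
    ≤ ((E.powerset).filter (fun lam => e z 1 ∈ lam ∧ 𝒱 lam ∧
        (b ∈ openCluster (ends '' (↑lam : Set ι)) u ∧ b ∉ openCluster (ends '' (↑(E \ lam) : Set ι)) u) ∧
        ((ha (openCluster (ends '' (↑lam : Set ι)) u) = 1 ∧ kb (openCluster (ends '' (↑lam : Set ι)) u) = 1 ∧
            hb (openCluster (ends '' (↑(E \ lam) : Set ι)) u) = 0 ∧ ka (openCluster (ends '' (↑(E \ lam) : Set ι)) u) = 0) ∨
          (ka (openCluster (ends '' (↑lam : Set ι)) u) = 1 ∧ hb (openCluster (ends '' (↑lam : Set ι)) u) = 1 ∧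
            kb (openCluster (ends '' (↑(E \ lam) : Set ι)) u) = 0 ∧ ha (openCluster (ends '' (↑(E \ lam) : Set ι)) u) = 0)))).card
      + ((E.powerset).filter (fun σ => (e z 1 ∈ σ ∨ Disjoint (A z) σ) ∧ 𝒱 σ ∧
        (b ∈ openCluster (ends '' (↑(E \ σ) : Set ι)) u ∧ b ∉ openCluster (ends '' (↑σ : Set ι)) u) ∧
        (ha (openCluster (ends '' (↑σ : Set ι)) u) = 1 ∧ ka (openCluster (ends '' (↑σ : Set ι)) u) = 1 ∧
          hb (openCluster (ends '' (↑(E \ σ) : Set ι)) u) = 0 ∧ kb (openCluster (ends '' (↑(E \ σ) : Set ι)) u) = 0))).card := by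
  set C : Finset ι → Set V := fun ω => openCluster (ends '' (↑ω : Set ι)) u with hC
  have hr : 0 < r := lt_of_le_of_lt (Nat.zero_le z) hz
  have hAE : ∀ t, t < r → A t ⊆ E := fun t ht i hi => (hEA i).mpr ⟨t, ht, hi⟩
  have heA : ∀ t, t < r → ∀ j, 1 ≤ j → j ≤ L t → e t j ∈ A t := fun t ht j hj1 hjL => (hA t ht _).mpr ⟨j, hj1, hjL, rfl⟩
  have full_iff : ∀ ω : Finset ι, ω ⊆ E → (b ∈ C ω ↔ ∃ t, t < r ∧ A t ⊆ ω) := fun ω hω =>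
    bundle_b_mem_cluster_iff_threads ends r L hL w e u b hr hw0 hwL harc hwinj hcross A hA E hEA ω hω
  have hz1 : e z 1 ∈ A z := heA z hz 1 (le_refl 1) (hL z hz)
  have hAc : A c = {e c 1} := by
    ext i
    rw [hA c hc i, Finset.mem_singleton]
    constructor
    · rintro ⟨j, hj1, hjL, rfl⟩
      have : j = 1 := by rw [hLc] at hjL; omega
      rw [this]
    · intro hi; exact ⟨1, le_refl 1, by rw [hLc], hi.symm⟩
  have src_no_chord : ∀ σ : Finset ι, σ ⊆ E → (b ∈ C (E \ σ) ∧ b ∉ C σ) → e c 1 ∉ σ := by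
    intro σ hσ hN hm
    exact hN.2 ((full_iff σ hσ).mpr ⟨c, hc, by rw [hAc]; exact Finset.singleton_subset_iff.mpr hm⟩)
  -- ## (1) splitting the sources: red-starting on z / z blue
  have f1 : ((E.powerset).filter (fun σ => (e z 1 ∈ σ ∨ Disjoint (A z) σ) ∧ 𝒱 σ ∧ (b ∈ C (E \ σ) ∧ b ∉ C σ) ∧ (ha (C σ) = 1 ∧ hb (C (E \ σ)) = 0)
        ∧ (kb (C (E \ σ)) = 1 ∧ ka (C σ) = 0))).card =
      ((E.powerset).filter (fun σ => e z 1 ∈ σ ∧ 𝒱 σ ∧ (b ∈ C (E \ σ) ∧ b ∉ C σ) ∧ (ha (C σ) = 1 ∧ hb (C (E \ σ)) = 0) ∧ (kb (C (E \ σ)) = 1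
            ∧ ka (C σ) = 0))).card + ((E.powerset).filter (fun σ => Disjoint (A z) σ ∧ 𝒱 σ ∧ (b ∈ C (E \ σ) ∧ b ∉ C σ) ∧ (ha (C σ) = 1 ∧ hb (C (E \ σ)) = 0)
            ∧ (kb (C (E \ σ)) = 1 ∧ ka (C σ) = 0))).card := by
    rw [← Finset.card_union_of_disjoint]
    · congr 1
      ext σ
      simp only [Finset.mem_filter, Finset.mem_union]
      tauto
    · rw [Finset.disjoint_filter]
      intro σ _ h1 h2
      exact Finset.disjoint_left.mp h2.1 hz1 h1.1
  have f2 : ((E.powerset).filter (fun σ => (e z 1 ∈ σ ∨ Disjoint (A z) σ) ∧ 𝒱 σ ∧ (b ∈ C (E \ σ) ∧ b ∉ C σ) ∧ (ka (C σ) = 1 ∧ kb (C (E \ σ)) = 0)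
        ∧ (hb (C (E \ σ)) = 1 ∧ ha (C σ) = 0))).card =
      ((E.powerset).filter (fun σ => e z 1 ∈ σ ∧ 𝒱 σ ∧ (b ∈ C (E \ σ) ∧ b ∉ C σ) ∧ (ka (C σ) = 1 ∧ kb (C (E \ σ)) = 0) ∧ (hb (C (E \ σ)) = 1
            ∧ ha (C σ) = 0))).card + ((E.powerset).filter (fun σ => Disjoint (A z) σ ∧ 𝒱 σ ∧ (b ∈ C (E \ σ) ∧ b ∉ C σ) ∧ (ka (C σ) = 1 ∧ kb (C (E \ σ)) = 0)
            ∧ (hb (C (E \ σ)) = 1 ∧ ha (C σ) = 0))).card := by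
    rw [← Finset.card_union_of_disjoint]
    · congr 1
      ext σ
      simp only [Finset.mem_filter, Finset.mem_union]
      tauto
    · rw [Finset.disjoint_filter]
      intro σ _ h1 h2
      exact Finset.disjoint_left.mp h2.1 hz1 h1.1
  -- the same for the P₁ targets
  have fP : ((E.powerset).filter (fun σ => (e z 1 ∈ σ ∨ Disjoint (A z) σ) ∧ 𝒱 σ ∧ (b ∈ C (E \ σ) ∧ b ∉ C σ) ∧
        (ha (C σ) = 1 ∧ ka (C σ) = 1 ∧ hb (C (E \ σ)) = 0 ∧ kb (C (E \ σ)) = 0))).card =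
      ((E.powerset).filter (fun σ => e z 1 ∈ σ ∧ 𝒱 σ ∧ (b ∈ C (E \ σ) ∧ b ∉ C σ) ∧
        (ha (C σ) = 1 ∧ ka (C σ) = 1 ∧ hb (C (E \ σ)) = 0 ∧ kb (C (E \ σ)) = 0))).card
      + ((E.powerset).filter (fun σ => Disjoint (A z) σ ∧ 𝒱 σ ∧ (b ∈ C (E \ σ) ∧ b ∉ C σ) ∧
        (ha (C σ) = 1 ∧ ka (C σ) = 1 ∧ hb (C (E \ σ)) = 0 ∧ kb (C (E \ σ)) = 0))).card := by
    rw [← Finset.card_union_of_disjoint]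
    · congr 1
      ext σ
      simp only [Finset.mem_filter, Finset.mem_union]
      tauto
    · rw [Finset.disjoint_filter]
      intro σ _ h1 h2
      exact Finset.disjoint_left.mp h2.1 hz1 h1.1
  -- ## (2) the z-blue sources: THEOREM BI with the chord among the frozen threads
  have hBI := bundle_boundary_count ends r L hL w e u b hw0 hwL harc hwinj hcross A hA hAdisj E hEA x y hx hy hxy z hz hzx hzy 𝒱 hV
    ha hb ka kb mha mhb mka mkb ha01 hb01 ka01 kb01
  have hPQ : ∀ σ : Finset ι, (b ∈ C (E \ σ) ∧ b ∉ C σ) → (σ ⊆ A x ∪ A y ↔ σ ⊆ E ∧ Disjoint (A z) σ) := by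
    intro σ hN; constructor
    · intro hσ; refine ⟨fun i hi => ?_, Finset.disjoint_left.mpr fun i hiz hiσ => ?_⟩
      · rcases Finset.mem_union.mp (hσ hi) with h | h
        · exact hAE x hx h
        · exact hAE y hy h
      · rcases Finset.mem_union.mp (hσ hiσ) with h | h
        · exact Finset.disjoint_left.mp (hAdisj z x hz hx hzx) hiz h
        · exact Finset.disjoint_left.mp (hAdisj z y hz hy hzy) hiz h
    · rintro ⟨hσE, hd⟩ i hi
      obtain ⟨t, ht, hit⟩ := (hEA i).mp (hσE hi)
      rcases hr4 t ht with rfl | rfl | rfl | rfl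
      · exact absurd hi (Finset.disjoint_left.mp hd hit)
      · exact Finset.mem_union_left _ hit
      · exact Finset.mem_union_right _ hit
      · rw [hAc, Finset.mem_singleton] at hit
        rw [hit] at hi
        exact absurd hi (src_no_chord σ hσE hN)
  have hPQE : A x ∪ A y ⊆ E := Finset.union_subset (hAE x hx) (hAE y hy)
  -- the three filter identities between the two presentations of the z-blue points
  have g1 : ((E.powerset).filter (fun σ => Disjoint (A z) σ ∧ 𝒱 σ ∧ (b ∈ C (E \ σ) ∧ b ∉ C σ) ∧ (ha (C σ) = 1 ∧ hb (C (E \ σ)) = 0)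
        ∧ (kb (C (E \ σ)) = 1 ∧ ka (C σ) = 0))) = ((A x ∪ A y).powerset).filter (fun ξ => 𝒱 ξ ∧ (b ∈ C (E \ ξ) ∧ b ∉ C ξ) ∧
        (ha (C ξ) = 1 ∧ kb (C (E \ ξ)) = 1 ∧ hb (C (E \ ξ)) = 0 ∧ ka (C ξ) = 0)) := by
    ext σ
    simp only [Finset.mem_filter, Finset.mem_powerset]
    constructor
    · rintro ⟨hσE, hd, hv, hN, hh, hk⟩
      exact ⟨(hPQ σ hN).mpr ⟨hσE, hd⟩, hv, hN, hh.1, hk.1, hh.2, hk.2⟩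
    · rintro ⟨hσ, hv, hN, h1, h2, h3, h4⟩
      obtain ⟨hσE, hd⟩ := (hPQ σ hN).mp hσ
      exact ⟨hσE, hd, hv, hN, ⟨h1, h3⟩, ⟨h2, h4⟩⟩
  have g2 : ((E.powerset).filter (fun σ => Disjoint (A z) σ ∧ 𝒱 σ ∧ (b ∈ C (E \ σ) ∧ b ∉ C σ) ∧ (ka (C σ) = 1 ∧ kb (C (E \ σ)) = 0)
        ∧ (hb (C (E \ σ)) = 1 ∧ ha (C σ) = 0))) = ((A x ∪ A y).powerset).filter (fun ξ => 𝒱 ξ ∧ (b ∈ C (E \ ξ) ∧ b ∉ C ξ) ∧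
        (hb (C (E \ ξ)) = 1 ∧ ka (C ξ) = 1 ∧ ha (C ξ) = 0 ∧ kb (C (E \ ξ)) = 0)) := by
    ext σ
    simp only [Finset.mem_filter, Finset.mem_powerset]
    constructor
    · rintro ⟨hσE, hd, hv, hN, hk, hh⟩
      exact ⟨(hPQ σ hN).mpr ⟨hσE, hd⟩, hv, hN, hh.1, hk.1, hh.2, hk.2⟩
    · rintro ⟨hσ, hv, hN, h1, h2, h3, h4⟩
      obtain ⟨hσE, hd⟩ := (hPQ σ hN).mp hσ
      exact ⟨hσE, hd, hv, hN, ⟨h2, h4⟩, ⟨h1, h3⟩⟩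
  have g3 : ((E.powerset).filter (fun σ => Disjoint (A z) σ ∧ 𝒱 σ ∧ (b ∈ C (E \ σ) ∧ b ∉ C σ) ∧
        (ha (C σ) = 1 ∧ ka (C σ) = 1 ∧ hb (C (E \ σ)) = 0 ∧ kb (C (E \ σ)) = 0))) = ((A x ∪ A y).powerset).filter (fun ξ => 𝒱 ξ ∧
        (b ∈ C (E \ ξ) ∧ b ∉ C ξ) ∧ (ha (C ξ) = 1 ∧ ka (C ξ) = 1 ∧ hb (C (E \ ξ)) = 0 ∧ kb (C (E \ ξ)) = 0)) := by
    ext σ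
    simp only [Finset.mem_filter, Finset.mem_powerset]
    constructor
    · rintro ⟨hσE, hd, hv, hN, hst⟩
      exact ⟨(hPQ σ hN).mpr ⟨hσE, hd⟩, hv, hN, hst⟩
    · rintro ⟨hσ, hv, hN, hst⟩
      obtain ⟨hσE, hd⟩ := (hPQ σ hN).mp hσ
      exact ⟨hσE, hd, hv, hN, hst⟩
  -- the lifts `ξ ∪ (A z ∪ A c)` are `z`-full targets
  have hO : E \ (A x ∪ A y) = A z ∪ A c := by
    ext i; simp only [Finset.mem_sdiff, Finset.mem_union]; constructor
    · rintro ⟨hiE, hn⟩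
      obtain ⟨t, ht, hit⟩ := (hEA i).mp hiE
      rcases hr4 t ht with rfl | rfl | rfl | rfl
      · exact Or.inl hit
      · exact absurd (Or.inl hit) hn
      · exact absurd (Or.inr hit) hn
      · exact Or.inr hit
    · rintro (hi | hi)
      · exact ⟨hAE z hz hi, fun h => h.elim (fun h => Finset.disjoint_left.mp (hAdisj z x hz hx hzx) hi h)
          fun h => Finset.disjoint_left.mp (hAdisj z y hz hy hzy) hi h⟩
      · exact ⟨hAE c hc hi, fun h => h.elim (fun h => Finset.disjoint_left.mp (hAdisj c x hc hx hxc.symm) hi h)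
          fun h => Finset.disjoint_left.mp (hAdisj c y hc hy hyc.symm) hi h⟩
  have f4 : (((A x ∪ A y).powerset).filter (fun ξ => 𝒱 (ξ ∪ E \ (A x ∪ A y)) ∧ (b ∈ C (ξ ∪ E \ (A x ∪ A y)) ∧ b ∉ C (E \ (ξ ∪ E \ (A x ∪ A y)))) ∧
      ((ha (C (ξ ∪ E \ (A x ∪ A y))) = 1 ∧ kb (C (ξ ∪ E \ (A x ∪ A y))) = 1 ∧ hb (C (E \ (ξ ∪ E \ (A x ∪ A y)))) = 0 ∧ ka (C (E \ (ξ ∪ E \ (A x ∪ A y)))) = 0) ∨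
        (ka (C (ξ ∪ E \ (A x ∪ A y))) = 1 ∧ hb (C (ξ ∪ E \ (A x ∪ A y))) = 1 ∧ kb (C (E \ (ξ ∪ E \ (A x ∪ A y)))) = 0
              ∧ ha (C (E \ (ξ ∪ E \ (A x ∪ A y)))) = 0)))).card ≤ ((E.powerset).filter (fun lam => A z ⊆ lam ∧ 𝒱 lam ∧ (b ∈ C lam ∧ b ∉ C (E \ lam)) ∧
      ((ha (C lam) = 1 ∧ kb (C lam) = 1 ∧ hb (C (E \ lam)) = 0 ∧ ka (C (E \ lam)) = 0) ∨
        (ka (C lam) = 1 ∧ hb (C lam) = 1 ∧ kb (C (E \ lam)) = 0 ∧ ha (C (E \ lam)) = 0)))).card := by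
    refine Finset.card_le_card_of_injOn (fun ξ => ξ ∪ E \ (A x ∪ A y)) (fun ξ hξ => ?_) ?_
    · rw [Finset.mem_coe, Finset.mem_filter, Finset.mem_powerset] at hξ
      rw [Finset.mem_coe, Finset.mem_filter, Finset.mem_powerset]
      refine ⟨Finset.union_subset (hξ.1.trans hPQE) Finset.sdiff_subset, ?_, hξ.2⟩
      rw [hO]; exact (Finset.subset_union_left).trans Finset.subset_union_right
    · intro ξ hξ ξ' hξ' heq
      rw [Finset.mem_coe, Finset.mem_filter, Finset.mem_powerset] at hξ hξ'
      have d1 : Disjoint ξ (E \ (A x ∪ A y)) := Finset.disjoint_left.mpr fun i hi hi' => (Finset.mem_sdiff.mp hi').2 (hξ.1 hi)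
      have d2 : Disjoint ξ' (E \ (A x ∪ A y)) := Finset.disjoint_left.mpr fun i hi hi' => (Finset.mem_sdiff.mp hi').2 (hξ'.1 hi)
      have h1 : (ξ ∪ E \ (A x ∪ A y)) \ (E \ (A x ∪ A y)) = ξ := by
        rw [Finset.union_sdiff_right, Finset.sdiff_eq_self_of_disjoint d1]
      have h2 : (ξ' ∪ E \ (A x ∪ A y)) \ (E \ (A x ∪ A y)) = ξ' := by
        rw [Finset.union_sdiff_right, Finset.sdiff_eq_self_of_disjoint d2]
      have := congrArg (fun s => s \ (E \ (A x ∪ A y))) heq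
      simp only [h1, h2] at this
      exact this
  have f3 : ((E.powerset).filter (fun σ => Disjoint (A z) σ ∧ 𝒱 σ ∧ (b ∈ C (E \ σ) ∧ b ∉ C σ) ∧ (ha (C σ) = 1 ∧ hb (C (E \ σ)) = 0) ∧ (kb (C (E \ σ)) = 1
        ∧ ka (C σ) = 0))).card + ((E.powerset).filter (fun σ => Disjoint (A z) σ ∧ 𝒱 σ ∧ (b ∈ C (E \ σ) ∧ b ∉ C σ) ∧ (ka (C σ) = 1 ∧ kb (C (E \ σ)) = 0)
        ∧ (hb (C (E \ σ)) = 1 ∧ ha (C σ) = 0))).card ≤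
      ((E.powerset).filter (fun lam => A z ⊆ lam ∧ 𝒱 lam ∧ (b ∈ C lam ∧ b ∉ C (E \ lam)) ∧
      ((ha (C lam) = 1 ∧ kb (C lam) = 1 ∧ hb (C (E \ lam)) = 0 ∧ ka (C (E \ lam)) = 0) ∨
        (ka (C lam) = 1 ∧ hb (C lam) = 1 ∧ kb (C (E \ lam)) = 0 ∧ ha (C (E \ lam)) = 0)))).card
      + ((E.powerset).filter (fun σ => Disjoint (A z) σ ∧ 𝒱 σ ∧ (b ∈ C (E \ σ) ∧ b ∉ C σ) ∧
        (ha (C σ) = 1 ∧ ka (C σ) = 1 ∧ hb (C (E \ σ)) = 0 ∧ kb (C (E \ σ)) = 0))).card := by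
    rw [g1, g2, g3]
    exact hBI.trans (Nat.add_le_add_right f4 _)
  -- ## (3) the sources starting red on z: class by class
  have nofull : ∀ σ : Finset ι, σ ⊆ E → b ∉ C σ → ∀ t, t < r → ∃ j, 1 ≤ j ∧ j ≤ L t ∧ e t j ∉ σ := by
    intro σ hσ hb' t ht; by_contra hno; push Not at hno
    exact hb' ((full_iff σ hσ).mpr ⟨t, ht, fun i hi => by
      obtain ⟨j, hj1, hjL, rfl⟩ := (hA t ht i).mp hi
      exact hno j hj1 hjL⟩)
  have cover : ∀ σ : Finset ι, σ ⊆ E → e z 1 ∈ σ → b ∉ C σ →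
      ∃ a ∈ Finset.Icc 1 (L z - 1), (∀ j, 1 ≤ j → j ≤ a → e z j ∈ σ) ∧ e z (a + 1) ∉ σ := by
    intro σ hσ h1 hb'
    have hex : ∃ j, 1 ≤ j ∧ j ≤ L z ∧ e z j ∉ σ := nofull σ hσ hb' z hz
    obtain ⟨hj₀1, hj₀ℓ, hj₀σ⟩ := Nat.find_spec hex
    have hmin : ∀ j, j < Nat.find hex → 1 ≤ j → j ≤ L z → e z j ∈ σ := by
      intro j hj hj1 hjℓ
      by_contra hn
      exact Nat.find_min hex hj ⟨hj1, hjℓ, hn⟩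
    have hj₀2 : 2 ≤ Nat.find hex := by
      by_contra h
      have h1' : Nat.find hex = 1 := by omega
      rw [h1'] at hj₀σ; exact hj₀σ h1
    refine ⟨Nat.find hex - 1, Finset.mem_Icc.mpr ⟨by omega, by omega⟩, fun j hj1 hja => hmin j (by omega) hj1 (by omega), ?_⟩
    have hj : Nat.find hex - 1 + 1 = Nat.find hex := by omega
    rw [hj]; exact hj₀σ
  -- abbreviations for the class families
  set S₁ : ℕ → Finset (Finset ι) := fun a => (E.powerset).filter (fun σ => ((∀ j, 1 ≤ j → j ≤ a → e z j ∈ σ) ∧ e z (a + 1) ∉ σ) ∧ 𝒱 σ ∧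
      (b ∈ C (E \ σ) ∧ b ∉ C σ) ∧ (ha (C σ) = 1 ∧ hb (C (E \ σ)) = 0) ∧ (kb (C (E \ σ)) = 1 ∧ ka (C σ) = 0)) with hS₁
  set S₂ : ℕ → Finset (Finset ι) := fun a => (E.powerset).filter (fun σ => ((∀ j, 1 ≤ j → j ≤ a → e z j ∈ σ) ∧ e z (a + 1) ∉ σ) ∧ 𝒱 σ ∧
      (b ∈ C (E \ σ) ∧ b ∉ C σ) ∧ (ka (C σ) = 1 ∧ kb (C (E \ σ)) = 0) ∧ (hb (C (E \ σ)) = 1 ∧ ha (C σ) = 0)) with hS₂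
  set Tcl : ℕ → Finset (Finset ι) := fun a => (E.powerset).filter (fun lam => ((∀ j, 1 ≤ j → j ≤ a → e z j ∈ lam) ∧ e z (a + 1) ∉ lam) ∧ 𝒱 lam ∧
      (b ∈ C lam ∧ b ∉ C (E \ lam)) ∧
      ((ha (C lam) = 1 ∧ kb (C lam) = 1 ∧ hb (C (E \ lam)) = 0 ∧ ka (C (E \ lam)) = 0) ∨
        (ka (C lam) = 1 ∧ hb (C lam) = 1 ∧ kb (C (E \ lam)) = 0 ∧ ha (C (E \ lam)) = 0))) with hTcl
  set Pcl : ℕ → Finset (Finset ι) := fun a => (E.powerset).filter (fun σ => ((∀ j, 1 ≤ j → j ≤ a → e z j ∈ σ) ∧ e z (a + 1) ∉ σ) ∧ 𝒱 σ ∧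
      (b ∈ C (E \ σ) ∧ b ∉ C σ) ∧ (ha (C σ) = 1 ∧ ka (C σ) = 1 ∧ hb (C (E \ σ)) = 0 ∧ kb (C (E \ σ)) = 0)) with hPcl
  have cov₁ : ((E.powerset).filter (fun σ => e z 1 ∈ σ ∧ 𝒱 σ ∧ (b ∈ C (E \ σ) ∧ b ∉ C σ) ∧ (ha (C σ) = 1 ∧ hb (C (E \ σ)) = 0) ∧ (kb (C (E \ σ)) = 1 ∧ ka (C σ) = 0)))
      ⊆ (Finset.Icc 1 (L z - 1)).biUnion S₁ := by
    intro σ hσ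
    rw [Finset.mem_filter, Finset.mem_powerset] at hσ
    obtain ⟨a, ha', hcla⟩ := cover σ hσ.1 hσ.2.1 hσ.2.2.2.1.2
    exact Finset.mem_biUnion.mpr ⟨a, ha', by rw [hS₁]; exact Finset.mem_filter.mpr ⟨Finset.mem_powerset.mpr hσ.1, hcla, hσ.2.2⟩⟩
  have cov₂ : ((E.powerset).filter (fun σ => e z 1 ∈ σ ∧ 𝒱 σ ∧ (b ∈ C (E \ σ) ∧ b ∉ C σ) ∧ (ka (C σ) = 1 ∧ kb (C (E \ σ)) = 0) ∧ (hb (C (E \ σ)) = 1 ∧ ha (C σ) = 0)))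
      ⊆ (Finset.Icc 1 (L z - 1)).biUnion S₂ := by
    intro σ hσ
    rw [Finset.mem_filter, Finset.mem_powerset] at hσ
    obtain ⟨a, ha', hcla⟩ := cover σ hσ.1 hσ.2.1 hσ.2.2.2.1.2
    exact Finset.mem_biUnion.mpr ⟨a, ha', by rw [hS₂]; exact Finset.mem_filter.mpr ⟨Finset.mem_powerset.mpr hσ.1, hcla, hσ.2.2⟩⟩
  have f5 : ((E.powerset).filter (fun σ => e z 1 ∈ σ ∧ 𝒱 σ ∧ (b ∈ C (E \ σ) ∧ b ∉ C σ) ∧ (ha (C σ) = 1 ∧ hb (C (E \ σ)) = 0) ∧ (kb (C (E \ σ)) = 1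
        ∧ ka (C σ) = 0))).card ≤ ∑ a ∈ Finset.Icc 1 (L z - 1), (S₁ a).card :=
    le_trans (Finset.card_le_card cov₁) Finset.card_biUnion_le
  have f6 : ((E.powerset).filter (fun σ => e z 1 ∈ σ ∧ 𝒱 σ ∧ (b ∈ C (E \ σ) ∧ b ∉ C σ) ∧ (ka (C σ) = 1 ∧ kb (C (E \ σ)) = 0) ∧ (hb (C (E \ σ)) = 1
        ∧ ha (C σ) = 0))).card ≤ ∑ a ∈ Finset.Icc 1 (L z - 1), (S₂ a).card :=
    le_trans (Finset.card_le_card cov₂) Finset.card_biUnion_le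
  have percls : ∀ a ∈ Finset.Icc 1 (L z - 1), (S₁ a).card + (S₂ a).card ≤ (Tcl a).card + (Pcl a).card := by
    intro a ha'
    rw [Finset.mem_Icc] at ha'
    have k := bundle_chorded_class_count ends r L hL w e u b hw0 hwL harc hwinj hcross A hA hAdisj E hEA z x y c hz hx hy hc hzx hzy hzc hxy hxc hyc hr4 hLc
      a ha'.1 (by omega) 𝒱 hV ha hb ka kb mha mhb mka mkb ha01 hb01 ka01 kb01
    rw [hS₁, hS₂, hTcl, hPcl]
    convert k using 3
  have f7 : ∑ a ∈ Finset.Icc 1 (L z - 1), (S₁ a).card + ∑ a ∈ Finset.Icc 1 (L z - 1), (S₂ a).card ≤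
      ∑ a ∈ Finset.Icc 1 (L z - 1), (Tcl a).card + ∑ a ∈ Finset.Icc 1 (L z - 1), (Pcl a).card := by
    rw [← Finset.sum_add_distrib, ← Finset.sum_add_distrib]; exact Finset.sum_le_sum percls
  have clsdisj : ∀ (F : ℕ → Finset (Finset ι)), (∀ a lam, lam ∈ F a → (∀ j, 1 ≤ j → j ≤ a → e z j ∈ lam) ∧ e z (a + 1) ∉ lam) →
      ∀ a ∈ Finset.Icc 1 (L z - 1), ∀ a' ∈ Finset.Icc 1 (L z - 1), a ≠ a' → Disjoint (F a) (F a') := by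
    intro F hF a _ a' _ hne
    rw [Finset.disjoint_left]
    intro lam h1 h2
    have c1 := hF a lam h1; have c2 := hF a' lam h2
    rcases Nat.lt_or_gt_of_ne hne with hlt | hlt
    · exact c1.2 (c2.1 (a + 1) (by omega) (by omega))
    · exact c2.2 (c1.1 (a' + 1) (by omega) (by omega))
  have hTmem : ∀ a lam, lam ∈ Tcl a → (∀ j, 1 ≤ j → j ≤ a → e z j ∈ lam) ∧ e z (a + 1) ∉ lam := by
    intro a lam h; rw [hTcl, Finset.mem_filter] at h; exact h.2.1
  have hPmem : ∀ a σ, σ ∈ Pcl a → (∀ j, 1 ≤ j → j ≤ a → e z j ∈ σ) ∧ e z (a + 1) ∉ σ := by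
    intro a σ h; rw [hPcl, Finset.mem_filter] at h; exact h.2.1
  have clssubT : (Finset.Icc 1 (L z - 1)).biUnion Tcl ⊆ ((E.powerset).filter (fun lam => (e z 1 ∈ lam ∧ ¬ A z ⊆ lam) ∧ 𝒱 lam
              ∧ (b ∈ C lam ∧ b ∉ C (E \ lam)) ∧
      ((ha (C lam) = 1 ∧ kb (C lam) = 1 ∧ hb (C (E \ lam)) = 0 ∧ ka (C (E \ lam)) = 0) ∨
        (ka (C lam) = 1 ∧ hb (C lam) = 1 ∧ kb (C (E \ lam)) = 0 ∧ ha (C (E \ lam)) = 0)))) := by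
    intro lam hlam
    obtain ⟨a, ha', hmem⟩ := Finset.mem_biUnion.mp hlam
    rw [Finset.mem_Icc] at ha'
    rw [hTcl, Finset.mem_filter] at hmem
    rw [Finset.mem_filter]
    exact ⟨hmem.1, ⟨hmem.2.1.1 1 (le_refl 1) ha'.1, fun hsub => hmem.2.1.2 (hsub (heA z hz (a + 1) (by omega) (by omega)))⟩, hmem.2.2⟩
  have clssubP : (Finset.Icc 1 (L z - 1)).biUnion Pcl ⊆ ((E.powerset).filter (fun σ => e z 1 ∈ σ ∧ 𝒱 σ ∧ (b ∈ C (E \ σ) ∧ b ∉ C σ) ∧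
        (ha (C σ) = 1 ∧ ka (C σ) = 1 ∧ hb (C (E \ σ)) = 0 ∧ kb (C (E \ σ)) = 0))) := by
    intro σ hσ
    obtain ⟨a, ha', hmem⟩ := Finset.mem_biUnion.mp hσ
    rw [Finset.mem_Icc] at ha'
    rw [hPcl, Finset.mem_filter] at hmem
    rw [Finset.mem_filter]
    exact ⟨hmem.1, hmem.2.1.1 1 (le_refl 1) ha'.1, hmem.2.2⟩
  have f8 : ∑ a ∈ Finset.Icc 1 (L z - 1), (Tcl a).card ≤ ((E.powerset).filter (fun lam => (e z 1 ∈ lam ∧ ¬ A z ⊆ lam)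
              ∧ 𝒱 lam ∧ (b ∈ C lam ∧ b ∉ C (E \ lam)) ∧
      ((ha (C lam) = 1 ∧ kb (C lam) = 1 ∧ hb (C (E \ lam)) = 0 ∧ ka (C (E \ lam)) = 0) ∨
        (ka (C lam) = 1 ∧ hb (C lam) = 1 ∧ kb (C (E \ lam)) = 0 ∧ ha (C (E \ lam)) = 0)))).card := by
    rw [← Finset.card_biUnion (clsdisj Tcl hTmem)]
    exact Finset.card_le_card clssubT
  have f8P : ∑ a ∈ Finset.Icc 1 (L z - 1), (Pcl a).card ≤ ((E.powerset).filter (fun σ => e z 1 ∈ σ ∧ 𝒱 σ ∧ (b ∈ C (E \ σ) ∧ b ∉ C σ) ∧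
        (ha (C σ) = 1 ∧ ka (C σ) = 1 ∧ hb (C (E \ σ)) = 0 ∧ kb (C (E \ σ)) = 0))).card := by
    rw [← Finset.card_biUnion (clsdisj Pcl hPmem)]
    exact Finset.card_le_card clssubP
  -- ## (4) the two supply families are disjoint parts of the z-red-starting targets
  have f9 : ((E.powerset).filter (fun lam => A z ⊆ lam ∧ 𝒱 lam ∧ (b ∈ C lam ∧ b ∉ C (E \ lam)) ∧
      ((ha (C lam) = 1 ∧ kb (C lam) = 1 ∧ hb (C (E \ lam)) = 0 ∧ ka (C (E \ lam)) = 0) ∨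
        (ka (C lam) = 1 ∧ hb (C lam) = 1 ∧ kb (C (E \ lam)) = 0 ∧ ha (C (E \ lam)) = 0)))).card + ((E.powerset).filter (fun lam => (e z 1 ∈ lam ∧ ¬ A z ⊆ lam)
              ∧ 𝒱 lam ∧ (b ∈ C lam ∧ b ∉ C (E \ lam)) ∧
      ((ha (C lam) = 1 ∧ kb (C lam) = 1 ∧ hb (C (E \ lam)) = 0 ∧ ka (C (E \ lam)) = 0) ∨
        (ka (C lam) = 1 ∧ hb (C lam) = 1 ∧ kb (C (E \ lam)) = 0 ∧ ha (C (E \ lam)) = 0)))).card ≤ ((E.powerset).filter (fun lam => e z 1 ∈ lam ∧ 𝒱 lam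
              ∧ (b ∈ C lam ∧ b ∉ C (E \ lam)) ∧
      ((ha (C lam) = 1 ∧ kb (C lam) = 1 ∧ hb (C (E \ lam)) = 0 ∧ ka (C (E \ lam)) = 0) ∨
        (ka (C lam) = 1 ∧ hb (C lam) = 1 ∧ kb (C (E \ lam)) = 0 ∧ ha (C (E \ lam)) = 0)))).card := by
    rw [← Finset.card_union_of_disjoint]
    · apply Finset.card_le_card
      intro lam hlam
      rw [Finset.mem_union, Finset.mem_filter, Finset.mem_filter] at hlam
      rw [Finset.mem_filter]
      rcases hlam with h | h
      · exact ⟨h.1, h.2.1 hz1, h.2.2⟩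
      · exact ⟨h.1, h.2.1.1, h.2.2⟩
    · rw [Finset.disjoint_filter]
      intro lam _ h1 h2
      exact h2.1.2 h1.1
  have fin : ((E.powerset).filter (fun σ => (e z 1 ∈ σ ∨ Disjoint (A z) σ) ∧ 𝒱 σ ∧ (b ∈ C (E \ σ) ∧ b ∉ C σ) ∧ (ha (C σ) = 1 ∧ hb (C (E \ σ)) = 0)
        ∧ (kb (C (E \ σ)) = 1 ∧ ka (C σ) = 0))).card + ((E.powerset).filter (fun σ => (e z 1 ∈ σ ∨ Disjoint (A z) σ) ∧ 𝒱 σ ∧ (b ∈ C (E \ σ) ∧ b ∉ C σ)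
        ∧ (ka (C σ) = 1 ∧ kb (C (E \ σ)) = 0) ∧ (hb (C (E \ σ)) = 1 ∧ ha (C σ) = 0))).card ≤ ((E.powerset).filter (fun lam => e z 1 ∈ lam ∧ 𝒱 lam ∧ (b ∈ C lam
        ∧ b ∉ C (E \ lam)) ∧
      ((ha (C lam) = 1 ∧ kb (C lam) = 1 ∧ hb (C (E \ lam)) = 0 ∧ ka (C (E \ lam)) = 0) ∨
        (ka (C lam) = 1 ∧ hb (C lam) = 1 ∧ kb (C (E \ lam)) = 0 ∧ ha (C (E \ lam)) = 0)))).card + ((E.powerset).filter (fun σ => (e z 1 ∈ σ ∨ Disjoint (A z) σ) ∧ 𝒱 σ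
              ∧ (b ∈ C (E \ σ) ∧ b ∉ C σ) ∧ (ha (C σ) = 1 ∧ ka (C σ) = 1 ∧ hb (C (E \ σ)) = 0 ∧ kb (C (E \ σ)) = 0))).card := by
    omega
  convert fin using 3

end Coefficientwise

end Summit.CriticalPhenomena.PercolationContinuityZ3.Theorems
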